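import Literature.AlgebraicGeometry.Resolution.AlterationsSectionDivisor
import Literature.AlgebraicGeometry.Resolution.AlterationsBoundarySmoothLocus
import Literature.AlgebraicGeometry.Resolution.BlowupsFlatBaseChange
import Literature.AlgebraicGeometry.Motives.AlgebraicEquivalenceFamilyFiber
import Literature.AlgebraicGeometry.Motives.AlgebraicEquivalenceFibreDimension
import Literature.AlgebraicGeometry.Motives.GrothendieckComplexCech
import Literature.AlgebraicGeometry.Motives.OpenImmersionGraph
import Literature.AlgebraicGeometry.Motives.VarietiesRegularProofs
import Literature.AlgebraicGeometry.Motives.VarietiesDimensionProofs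
import HarnessLib

/-!
# A rational point of a smooth projective curve, and the slice `X × {t} ⊂ X × T`, are effective Cartier divisors

Topic: `Literature/AlgebraicGeometry/Resolution`. Theorem-only file (no definition, no named fact).
For a smooth projective curve `T` over an algebraically closed field `k` and a `k`-point `t ∈ T(k)`:

* `isEffectiveCartier_ker_toSpecHom` — **the kernel ideal sheaf of the closed immersion
  `t : Spec k ⟶ T` is an effective Cartier divisor** (the closed point `t`): at `t` its stalk is the
  maximal ideal of the regular, hence factorial, one-dimensional local ring `𝒪_{T,t}`, which is
  principal (`Ideal.exists_eq_span_singleton_of_ringKrullDim_quotient`), and an ideal sheaf with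
  principal non-zero stalks at the closed points of its support is an effective Cartier divisor on a
  Jacobson integral scheme (`isEffectiveCartier_of_stalkIdeal_eq_span_singleton_of_isClosed`;
  Hartshorne II 6.2, 6.11: on a regular curve Weil = Cartier);
* `ker_sliceAt_eq_comap` — the kernel of the slice `ι_t : X ⟶ X × T` is the pull-back of that ideal
  along `pr_T` (the slice square is cartesian, `isPullback_sliceAt`; Mathlib
  `Scheme.IdealSheafData.ker_fst_of_isClosedImmersion`);
* `isEffectiveCartier_ker_sliceAt` — **the slice `X × {t} ⊂ X × T` is an effective Cartier divisor**
  (`pr_T` is flat, `IsEffectiveCartier.comap_of_flat`) — the input "the centre `X × {∞}` of the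
  deformation to the normal cone restricts to a Cartier divisor on `X × ℙ¹`" of Fulton 1998, §5.1.

## References

* [Hartshorne1977] R. Hartshorne, Algebraic Geometry (1977), II Prop. 6.2, Prop. 6.11, Ex. II.6.
* [Fulton1998] W. Fulton, Intersection Theory, 2nd ed. (1998), §5.1, App. B.6.
* [StacksProject] The Stacks Project, Tag 01WS.
-/

noncomputable section

open CategoryTheory CategoryTheory.Limits AlgebraicGeometry TopologicalSpace Opposite
open MonoidalCategory CartesianMonoidalCategory
open Literature.AlgebraicGeometry.Motives

namespace Literature.AlgebraicGeometry.Resolution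

universe u

variable {k : Type u} [Field k]

/-- **A `k`-point of a smooth projective curve is an effective Cartier divisor**: the kernel ideal
sheaf of `t : Spec k ⟶ T` has, at the closed point `t`, the stalk `𝔪_{T,t}`, a non-zero principal
ideal of the one-dimensional regular local ring `𝒪_{T,t}`. [cite: Hartshorne1977, II Prop. 6.2 and Prop. 6.11]
[cite: StacksProject, Tag 01WS] -/
theorem isEffectiveCartier_ker_toSpecHom [IsAlgClosed k] {T : SchemeOver k}
    (hT : IsSmoothProjective 1 T) (t : AlgPoints T k) : IsEffectiveCartier t.toSpecHom.ker := by
  haveI : IsIntegral T.left := IsSmoothProjective.isIntegral_holds hT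
  haveI := hT.smoothOfRelativeDimension
  haveI : Smooth T.hom := SmoothOfRelativeDimension.smooth (n := 1) (f := T.hom)
  haveI : LocallyOfFiniteType T.hom := inferInstance
  haveI : IsLocallyNoetherian T.left := LocallyOfFiniteType.isLocallyNoetherian T.hom
  haveI : JacobsonSpace ↥T.left := LocallyOfFiniteType.jacobsonSpace T.hom
  haveI : IsClosedImmersion t.toSpecHom := AlgPoints.isClosedImmersion_toSpecHom T t
  refine isEffectiveCartier_of_stalkIdeal_eq_span_singleton_of_isClosed fun x hx hxc ↦ ?_
  -- `x` is the point `t`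
  have hx' : x ∈ Set.range t.toSpecHom := by
    have : x ∈ (t.toSpecHom.ker.support : Set T.left) := hx
    rwa [Scheme.Hom.support_ker, t.toSpecHom.isClosedEmbedding.isClosed_range.closure_eq] at this
  obtain ⟨y, rfl⟩ := hx'
  -- the stalk is a regular local ring of dimension `1`, hence factorial
  haveI : IsRegularLocalRing (T.left.presheaf.stalk (t.toSpecHom y)) :=
    isRegularLocalRing_stalk_of_smoothOfRelativeDimension (f := T.hom) (n := 1) _
  haveI : IsDomain (T.left.presheaf.stalk (t.toSpecHom y)) := isDomain_of_isRegularLocalRing _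
  haveI : UniqueFactorizationMonoid (T.left.presheaf.stalk (t.toSpecHom y)) :=
    IsRegularLocalRing.uniqueFactorizationMonoid _
  have hP := stalkIdeal_ker_eq_ker_stalkMap t.toSpecHom y
  have hsurj : Function.Surjective (t.toSpecHom.stalkMap y).hom := t.toSpecHom.stalkMap_surjective y
  haveI : Nonempty ↥T.left := ⟨t.toSpecHom y⟩
  have hB : ringKrullDim (T.left.presheaf.stalk (t.toSpecHom y)) = (0 + 1 : ℕ) := by
    rw [ringKrullDim_stalk_eq_of_isClosed T.hom hxc,
      topologicalKrullDim_eq_of_smoothOfRelativeDimension (f := T.hom) (n := 1)]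
  -- the quotient by the stalk ideal is the stalk of `Spec k`, a field
  have hk0 : ringKrullDim ((Spec (.of k)).presheaf.stalk y) = (0 : ℕ) := by
    haveI : Subsingleton ↥(Spec (CommRingCat.of k)) := inferInstanceAs (Subsingleton (PrimeSpectrum k))
    have hy : y = IsLocalRing.closedPoint k := Subsingleton.elim _ _
    subst hy
    rw [ringKrullDim_eq_of_ringEquiv (stalkClosedPointIso (.of k)).commRingCatIsoToRingEquiv]
    exact ringKrullDim_eq_zero_of_field k
  have hBP : ringKrullDim (T.left.presheaf.stalk (t.toSpecHom y) ⧸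
      stalkIdeal t.toSpecHom.ker (t.toSpecHom y)) = (0 : ℕ) := by
    rw [hP, ringKrullDim_eq_of_ringEquiv (RingHom.quotientKerEquivOfSurjective hsurj), hk0]
  have hne : stalkIdeal t.toSpecHom.ker (t.toSpecHom y) ≠ ⊥ := by
    intro h0
    rw [h0, ringKrullDim_eq_of_ringEquiv (RingEquiv.quotientBot _), hB] at hBP
    have h1 : (((0 + 1 : ℕ) : ℕ∞) : WithBot ℕ∞) = ((0 : ℕ) : ℕ∞) := hBP
    have h2 := ENat.coe_inj.mp (WithBot.coe_inj.mp h1)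
    omega
  haveI : IsDomain ((Spec (.of k)).presheaf.stalk y) := by
    haveI := isRegularLocalRing_stalk_Spec_field k y
    exact isDomain_of_isRegularLocalRing _
  haveI : (stalkIdeal t.toSpecHom.ker (t.toSpecHom y)).IsPrime := by
    rw [hP]
    exact RingHom.ker_isPrime _
  obtain ⟨p, hp, hPp⟩ := Ideal.exists_eq_span_singleton_of_ringKrullDim_quotient _ hne hB hBP
  exact ⟨p, hp.ne_zero, hPp⟩

/-- **The kernel of the slice is pulled back from the point**: for `t ∈ T(k)`,
`ker (ι_t : X ⟶ X × T) = (ker t) · 𝒪_{X × T}`, the inverse image ideal sheaf along `pr_T` (the slice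
square is cartesian). [cite: Fulton1998, §10.1] -/
theorem ker_sliceAt_eq_comap {X T : SchemeOver k} [LocallyOfFiniteType T.hom] (t : AlgPoints T k) :
    (sliceAt X t).left.ker = t.toSpecHom.ker.comap (snd X T).left := by
  haveI : IsClosedImmersion t.toSpecHom := AlgPoints.isClosedImmersion_toSpecHom T t
  have hP := isPullback_sliceAt (X := X) t
  rw [← Scheme.IdealSheafData.ker_fst_of_isClosedImmersion, ← hP.isoPullback_hom_fst,
    Scheme.Hom.ker_comp_of_isIso]

/-- **The slice `X × {t} ⊂ X × T` over a `k`-point of a smooth projective curve is an effective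
Cartier divisor** (its ideal is the pull-back along the flat projection `pr_T` of the Cartier
divisor `t`). [cite: Fulton1998, §5.1 and App. B.6] [cite: Hartshorne1977, II Prop. 6.11] -/
theorem isEffectiveCartier_ker_sliceAt [IsAlgClosed k] {X T : SchemeOver k}
    (hT : IsSmoothProjective 1 T) (t : AlgPoints T k) : IsEffectiveCartier (sliceAt X t).left.ker := by
  haveI := hT.smoothOfRelativeDimension
  haveI : Smooth T.hom := SmoothOfRelativeDimension.smooth (n := 1) (f := T.hom)
  haveI : LocallyOfFiniteType T.hom := inferInstance
  haveI : Flat (snd X T).left := flat_snd_left X T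
  rw [ker_sliceAt_eq_comap]
  exact (isEffectiveCartier_ker_toSpecHom hT t).comap_of_flat _

end Literature.AlgebraicGeometry.Resolution

end
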